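import Summits.Parity.GeneralizedHardyLittlewood.Theses.ZDegreeToeplitzBand
import Literature.NumberTheory.LFunctions.Zhang2022.KnifeEdgeLenLongLegChiWindow
import Literature.NumberTheory.LFunctions.Zhang2022.KnifeEdgeLenZDegreeClosedForms
import Literature.NumberTheory.LFunctions.Zhang2022.KnifeEdgeLenZDegreeMinors
import Summits.Parity.GeneralizedHardyLittlewood.Theorems.ZDegreeToeplitzBandLemma81ExtCell

/-! # Line `long-poly-dil` for crux `PsiGradedTablesClosePoly` (stmt-Parity-22438 = h2′ of `closes`, rev 17) — v2, RESHAPED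

S5 RESHAPE (director-frontier g10 T0+36h, ratified 2026-08-28T01:23:20Z; tenure ls-knife-plan g4): the v1 skeleton
(2026-08-27T22:25:08Z, sha 7f182f1d…) re-typed after the reads of record — ls-ref-1 SKELETON-READ findings 1–5, ls-knife-crit-1
guards (g1)/(g2), ls-knife-toeplitz-typer-1 g19 (P1: keyable ⇒ CELL, not class), ls-knife-typer-3 g20 BUDGET-P2Dil §4 (P2-Dil as
typed overdraws the one-log budget of `𝔠̃ ↦ 𝔠`; corrected signature = cell heads), theory's class→cell word. WHAT CHANGED:
* stub 1 `stub_formulaILongPsiDil` (Leg A on the whole dilated CLASS, `∀ B`) ↦ **`stub_formulaILongPsiDilCell`**: the same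
  estimate with the heads PINNED to the `𝒳₂` cell's datum `b₀ := upsHead χ`, `𝐚₂ := nuHead χ` (class members with `B = 1`,
  `LongLegSplit.upsHead_norm_le` / `nuHead_norm_le`; the unit-class normal form of the old stub is
  `Theorems.formulaILongPsiDil_iff_unit`, p582241). WEAKER than v1 (`formulaILongPsiDilCell_of_dil`, proved below).
* stub 3 `stub_lemma81LongPsiDil` (P2-Dil on the class, heads of length `D⁴` with `τ²/τ` majorants) ↦
  **`stub_lemma81LongPsiDilCell`**: typer-3's corrected cell signature; its M part is KERNEL — the stub is EXACTLY the
  conclusion of `Theorems.lemma81LongPsiDil_cell_of_meanSquare` (p586709), so it reduces by name to the cell mean square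
  `MeanSquareCellHeads` (= L_A, OPEN; `lemma81LongPsiDilCell_of_meanSquare` below). WEAKER than v1 (`lemma81LongPsiDilCell_of_dil`).
* stub 5 `stub_signTestLongPolyDil` ((A)-guarded «slots ⇒ every table-witness closes») is SPLIT (ref-1 finding 1, crit-1
  seconded) into (5a) **`stub_closedFormsOnClass`** — the TRANSFER: from the slots, under recurrence of (A), the degree-1 /
  dual / degree-2 psi cross tables hold ON `SubUnitPolyPairs` with the functionals of ONE closed-form triple `longPolyForms`
  (price M off the corner) — and (5b) **`stub_signTestClosedForms`** — the (A)-FREE SIGN TEST `GradedClosesOn SubUnitPolyPairs`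
  of that triple (guard (g2): the design binder is `GradedClosesOn`'s own `∃`-design, no pinned design; guard (g1): the triple is
  a bare `PsiGradedClosedForms` term — no `χ`, `D`, `ForAllLarge` inside). The glue «any table-witness agrees with the closed
  forms on class pairs, so closing transfers» is PROVED here (`gradedClosesOn_transfer`, from `crossTablePsiOn_unique` +
  `gradedMainMatrix_congr`; the dual-table uniqueness ON a class is supplied).
* THE DISPLAY HOLE. The closed-form triple on LONG sub-unit poly pairs that the slots would imply — `x₂^{long}` (DISPLAY #6
  cell (U): the Leg-A / Leg-B MAIN-TERM constants `X₂^𝕄 + wrap^𝕄_mean`, UNEVALUATED as closed forms by any seat, theory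
  M-RULEBOOK; the fluctuation `W` is exactly what stub 2 declares negligible) and `x₁^{long}`, `y₁^{long}` (owed item O7) — has
  no displayed VALUE. S4 DELIVERED (ls-knife-toeplitz-typer-1 g8, `K1A-DISPLAY-6-U-WRAP.md` v1.0 6be5f726, evidence #16/#17 on
  stmt-Parity-22438, 2026-08-28T01:47:29Z; desk read ls-ref-1 01:48:48Z WORD ACCEPTED): from the bounds of record the wrap and
  O7's cells admit ONLY `|cell| ≤ c(D)·√(𝔅𝔅)` with `c(D) = P^{u/2+o(1)}/𝔅 → ∞` (`u = θ_f + θ_g − 1`) and NO lower bound, at the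
  ratified `(0.9 − x)³` design and at every long sub-unit poly design ⇒ **UNDECIDED-AT-WALL ⇒ WALL-GATED** at
  `Literature.Barriers.Parity.LargeSieveLevelHalf` (`LargeSieveLevelHalf_holds`: `Δ(N,Q) ≥ max(N, Q²/4)` with `N = M* > Q²`) /
  `…LargeSieveLevelHalfNarrow` clause (1) (the ceiling is the absolute-value / Cauchy–Schwarz step (7.5)/(7.13)) = ESTAR E1/E2.
  The triple is therefore registered as the SEALED constant `longPolyForms := Classical.choice _`: kernel-opaque, so (5a)/(5b)
  are gated in the precise sense that nothing about `longPolyForms` beyond its type is provable — the typed form of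
  «UNEVALUATED / WALL-GATED»; no number is invented. UNSEALING = replacing that ONE definition body by a displayed term `E₀`
  (one-line edit + re-registration by a tenure / WAKE planner, the day an E1-type input or a main-term display exists); then
  (5b) is an explicit-real inequality ((A)-free, decidable per design: LIVE by `Negative.gradedClosesOn_of_det_neg` /
  `_alignedTriple_by_det` / `_mixedTriple` / `_of_minor··` / `gradedClosesOn_linear_nine_tenths_of_cell`; BELOW = killed by
  `Negative.not_gradedClosesOn_of_cells_le_three` (p594310) / `_le_mixed` (p592711) / `_le_half_geom` (p592244)) and (5a)
  the M-priced transfer.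
* stubs 2 (`stub_formulaILongDualDil`, K1-Dil = THE E1/E2 WALL, not a prover target) and 4 (`stub_degOneLongSlots`, K2 ∧ K1 ∧ P2
  of record; typer-3: P2 as typed has the same one-log wall, `Theorems.lemma81LongPsi_of_meanSquare`) are KEPT VERBATIM.
KEYING WORDS (for the lead): keyable now = stub 1′ (P1-cell, desk price L: (7.11)–(7.15) re-run for the dilated cell datum) and
L_A (`MeanSquareCellHeads`, the open analytic input of stub 3′); not keys = stub 2 (wall), stub 4's K1 conjunct (wall), (5a)/(5b)
until unsealed. VERDICT WORDS OF RECORD (ref-1 desk 01:25:18Z / 01:48:48Z): BELOW ⇒ `¬ (5b)` for a displayed triple by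
`not_gradedClosesOn_of_cells_le_three` / `_le_mixed` ((A)-free) and the line dies at (5b); LIVE ⇒ (5b) by certificate, the line
stands on (5a) + stubs 1′–4; UNDECIDED-AT-WALL (= S4's word, accepted) ⇒ nothing lands, the hole stays sealed: the line is
WALL-GATED at stub 2 and at the K1 conjunct of stub 4 (ratified T0+48h kill criterion's antecedent met as displayed; the
lead / director rule at 13:19:33Z). Edit C of the tenure plan (h1′ on the class, 20446 → 20446′) is MOOT while wall-gated
(desk 01:48:48Z) and is NOT made; this v2 is the typed record of the line as it goes to the T0+48h review.
The composition `PsiGradedTablesClosePoly_of` is hypothesis-free; sorries live ONLY in the six `stub_*` theorems.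
«The programme SEARCHES and TYPES; no claim about Landau–Siegel zeros, Theorems 1–2 of arXiv:2211.02515 or a repaired
Margin232 until a kernel theorem says so.» -/

namespace Summit.Parity.GeneralizedHardyLittlewood.Cruxes.PsiGradedTablesClosePoly.LongPolyDil

open Literature.NumberTheory.LFunctions.Zhang2022
open Literature.NumberTheory.LFunctions.Zhang2022.KnifeEdge
open Summit.Parity.GeneralizedHardyLittlewood.Theses.ZDegreeToeplitzBand

/-! ## Part 1 — the CELL slots (stubs 1′ and 3′) and the named open input L_A -/

noncomputable section CellSlots

open Complex Real ComplexConjugate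
open Literature.NumberTheory.LFunctions.Zhang2022.Skeleton
open Literature.NumberTheory.LFunctions.Zhang2022.Section8aStatements
open Literature.NumberTheory.LFunctions.Zhang2022.KnifeEdge.LongLegSplit

/-- **Leg A AT THE CELL** (`FormulaILongPsiDil c′` with the head class binders instantiated at the `𝒳₂` cell's datum:
`b₀ := upsHead χ = υ·1_{≤D⁴}`, `𝐚₂ := nuHead χ = ν·1_{≤D⁴}`; pieces, sup-normalisation, truncations, main term, `ℰ`-term and
the slack `ε·√D·𝔓` VERBATIM). The keyable object P1 of record (typer-1 g19 (e): «keyable ⇒ CELL»). OPEN; asserted by no one.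
[cite: Zhang2022LandauSiegel, §7 Prop. 7.1, (7.2), (7.11)–(7.15) p. 14, (7.18)–(7.21) p. 15; §8 (8.8) p. 16] -/
def FormulaILongPsiDilCell (c' : ℝ) : Prop :=
  ∀ ε : ℝ, 0 < ε → ∃ C : ℝ, ForAllLarge fun D _ χ => AssumptionA D χ →
    ∀ (g g' f f' : ℝ → ℂ), InClassPiece g g' → InClassPiece f f' →
      (∀ x ∈ Set.Icc (0:ℝ) 1, ‖g x‖ ≤ 1) → (∀ x ∈ Set.Icc (0:ℝ) 1, ‖f x‖ ≤ 1) →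
        ‖Theta1Ext c' χ (Nlong D) (Nsupp D) (longPsiData χ (dilHead D (upsHead χ)) g f) (nuHead χ)
            - mainMVExt c' D (Nlong D) (Nsupp D) (longPsiData χ (dilHead D (upsHead χ)) g f) (nuHead χ)‖
          ≤ C * EcalExt c' D (Nlong D) (Nsupp D) (longPsiData χ (dilHead D (upsHead χ)) g f) (nuHead χ)
            + ε * Real.sqrt D * frakP D

/-- The cell slot is WEAKER than the v1 class slot: instantiate `B = 1` at the cell's heads (`upsHead_norm_le/eq_zero`,
`nuHead_norm_le/eq_zero`). [cite: Zhang2022LandauSiegel, §7 (7.2); §8 (8.8)] -/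
theorem formulaILongPsiDilCell_of_dil {c' : ℝ} (h : FormulaILongPsiDil c') : FormulaILongPsiDilCell c' := by
  intro ε hε
  obtain ⟨C, D₀, hD₀⟩ := h 1 ε hε
  exact ⟨C, D₀, fun D _ χ hD hq hp hA g g' f f' hg hf hg1 hf1 =>
    hD₀ D χ hD hq hp hA (upsHead χ) g g' f f' (nuHead χ) hg hf hg1 hf1 (upsHead_norm_le χ)
      (fun _ hn => upsHead_eq_zero χ hn) (nuHead_norm_le χ) (fun _ hn => nuHead_eq_zero χ hn)⟩

/-- **Lemma 8.1 with extended truncations AT THE CELL** (`Lemma81LongPsiDil c′` with the heads pinned to `upsHead χ`,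
`nuHead χ`; short pieces of total length `≤ 2 − δ`, slack `ε·√D·𝔓`, VERBATIM otherwise) — typer-3's corrected signature of
stub 3 (BUDGET-P2Dil-g20 §4); literally the conclusion of `Theorems.lemma81LongPsiDil_cell_of_meanSquare` at `c′`. OPEN.
[cite: Zhang2022LandauSiegel, §8 Lemma 8.1 p. 16; §3 (3.1)] -/
def Lemma81LongPsiDilCell (c' : ℝ) : Prop :=
  ∀ δ : ℝ, 0 < δ → ∀ ε : ℝ, 0 < ε → ForAllLarge fun D _ χ => AssumptionA D χ →
    ∀ (g g' f f' : ℝ → ℂ) (θg θf : ℝ),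
      ShortPiece θg g g' → ShortPiece θf f f' → θg + θf ≤ 2 - δ →
      (∀ x ∈ Set.Icc (0:ℝ) 1, ‖g x‖ ≤ 1) → (∀ x ∈ Set.Icc (0:ℝ) 1, ‖f x‖ ≤ 1) →
        ‖lhs81Ext c' χ (Nlong D) (Nsupp D) (longPsiData χ (dilHead D (upsHead χ)) g f) (nuHead χ) -
            (Theta1Ext c' χ (Nlong D) (Nsupp D) (longPsiData χ (dilHead D (upsHead χ)) g f) (nuHead χ) +
              conj (Theta1Ext c' χ (Nsupp D) (Nlong D) (fun n => conj (nuHead χ n))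
                (fun n => conj (longPsiData χ (dilHead D (upsHead χ)) g f n))))‖
          ≤ ε * Real.sqrt D * frakP D

/-- The cell slot is WEAKER than the v1 class slot (`B = 1` at the cell's heads). [cite: Zhang2022LandauSiegel, §8 Lemma 8.1] -/
theorem lemma81LongPsiDilCell_of_dil {c' : ℝ} (h : Lemma81LongPsiDil c') : Lemma81LongPsiDilCell c' := by
  intro δ hδ ε hε
  obtain ⟨D₀, hD₀⟩ := h δ hδ 1 ε hε
  exact ⟨D₀, fun D _ χ hD hq hp hA g g' f f' θg θf hsg hsf hθ hg1 hf1 =>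
    hD₀ D χ hD hq hp hA (upsHead χ) g g' f f' (nuHead χ) θg θf hsg hsf hθ hg1 hf1 (upsHead_norm_le χ)
      (fun _ hn => upsHead_eq_zero χ hn) (nuHead_norm_le χ) (fun _ hn => nuHead_eq_zero χ hn)⟩

/-- **L_A — THE OPEN ANALYTIC INPUT OF STUB 3′, BY NAME** (the hypothesis `hMS` of `Theorems.lemma81LongPsiDil_cell_of_meanSquare`,
VERBATIM): for every `δ > 0` and `K > 0`, eventually in `D` under (A), for all short sup-normalised pieces with `θg + θf ≤ 2 − δ`,
the two mean squares over `Ψ₁` along `𝔍(α)` of `A_{Nlong}(𝐚₁;s)·A_{Nsupp}(ν1_{≤D⁴};1−s)` and of its reflection are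
`≤ K·D·P²·𝓛³⁸` (`𝐚₁ = longPsiData χ (dilHead D (upsHead χ)) g f`). Price of record (typer-3 g20 / theory): the one-log room
of `𝔠̃ ↦ 𝔠` — (A) may be used on `υ, ν` (lacunary at primes). OPEN; not a stub (stub 3′ is its consequence by a kernel theorem).
[cite: Zhang2022LandauSiegel, §8 Lemma 8.1 pp. 42–44; Lemma 3.3; Lemma 6.1] -/
def MeanSquareCellHeads : Prop :=
  ∀ δ : ℝ, 0 < δ → ∀ K : ℝ, 0 < K → ForAllLarge fun D _ χ => AssumptionA D χ →
    ∀ (g g' f f' : ℝ → ℂ) (θg θf : ℝ),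
      ShortPiece θg g g' → ShortPiece θf f f' → θg + θf ≤ 2 - δ →
      (∀ x ∈ Set.Icc (0:ℝ) 1, ‖g x‖ ≤ 1) → (∀ x ∈ Set.Icc (0:ℝ) 1, ‖f x‖ ≤ 1) →
      ∀ v ∈ Set.Icc (-ell1 D) (ell1 D),
        (∑ x ∈ finsetOf (PsiOne χ),
            ‖Lemma81.dirPoly (Nlong D) (longPsiData χ (dilHead D (upsHead χ)) g f) x.ψ
                  (((alpha D : ℝ) : ℂ) + s0 D + v * I) *
                Lemma81.dirPoly (Nsupp D) (nuHead χ) x.ψ⁻¹ (1 - (((alpha D : ℝ) : ℂ) + s0 D + v * I))‖ ^ 2 ≤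
          K * D * bigP D ^ 2 * ell D ^ 38) ∧
        (∑ x ∈ finsetOf (PsiOne χ),
            ‖Lemma81.dirPoly (Nsupp D) (fun n => conj (nuHead χ n)) x.ψ (((alpha D : ℝ) : ℂ) + s0 D + v * I) *
                Lemma81.dirPoly (Nlong D) (fun n => conj (longPsiData χ (dilHead D (upsHead χ)) g f n)) x.ψ⁻¹
                  (1 - (((alpha D : ℝ) : ℂ) + s0 D + v * I))‖ ^ 2 ≤ K * D * bigP D ^ 2 * ell D ^ 38)

/-- **Stub 3′ ⟸ L_A (kernel, p586709):** the cell mean square gives the cell slot for all large `c′`, by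
`Theorems.lemma81LongPsiDil_cell_of_meanSquare` verbatim. [cite: Zhang2022LandauSiegel, §8 Lemma 8.1 pp. 42–44] -/
theorem lemma81LongPsiDilCell_of_meanSquare (hMS : MeanSquareCellHeads) :
    ∃ c₀ : ℝ, ∀ c' : ℝ, c₀ ≤ c' → Lemma81LongPsiDilCell c' :=
  Summit.Parity.GeneralizedHardyLittlewood.Theorems.lemma81LongPsiDil_cell_of_meanSquare hMS

end CellSlots

/-! ## Part 2 — the registered stubs 1′, 2, 3′, 4 -/

/-- stub 1′ (P1-CELL — KEYABLE; desk price L): Leg A for the dilated CELL datum, eventually in the contour parameter `c′`.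
Inputs kernel by name: `LongLegSplit.chiWindowBound_dilHead` / `chiWindowBound_x2Cell` (the χ-window structure is a THEOREM
at the cell), `Theorems.formulaILongPsi_dilHead` (p582241: K2's class already contains the dilated head at amplitude `D`, so the
`√D`-slack is the whole content), the O5 bridge, (p3), (p5). Why it might fail: (7.11)–(7.15) re-run for the dilated datum has
zero room; (7.3)–(7.5) never absorbs a scalar `D^k`. -/
theorem stub_formulaILongPsiDilCell : ∃ c₀ : ℝ, ∀ c' : ℝ, c₀ ≤ c' → FormulaILongPsiDilCell c' := by
  sorry

/-- stub 2 (K1-Dil — THE E1/E2 WALL; NOT a prover target: a disprover / strategist object; KEPT VERBATIM from v1):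
**«WALL-GATED at `Literature.Barriers.Parity.LargeSieveLevelHalf` (`LargeSieveLevelHalf_holds`), S4 `K1A-DISPLAY-6-U-WRAP.md`
v1.0 6be5f72626c5ee6f, desk 01:48:48Z»** (word of record, ls-lead g6 01:52:01Z (i)). Leg B re-typed with the dilated long k-side
head; S4: its wrap `W := Θ₁Ext(Nsupp,Nlong)(ā₂,ā₁) − mainMVExt(…)` admits only the dual large-sieve bound `P^{u/2+o(1)}·(…)·𝔞𝔓`
(`u = θ_f + θ_g − 1`; CS over `(ψ,s)` × any admissible large-sieve constant `Δ(N,Q) ≥ max(N, Q²/4)` with `N = M* = D⁶P^{1+λ}t₀ > Q²`;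
`…LargeSieveLevelHalfNarrow` clause (1): the ceiling is the absolute-value step (7.5)/(7.13)) and NO lower bound — BC9-style:
method_family = dispersion + CS/large-sieve on the Kloosterman-weighted Leg-B bilinear form; ladder_ceiling = capped at the LS
`N`-term (head length `M* >` the `|Ψ|`-scale); ceiling_lift = an E1-class non-large-sieve bound for the automorphic head
`d₃^{(β)}⋆χ` with saving `≥ P^{u/2}` (OPEN in print) = the WAKE KEY. Why it might fail: it is the wall — reciprocity moduli
`k ≍ P^λ D^{O(1)} > p`, the dual large sieve (7.15) loses `P^{(λ−1)/2}`. -/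
theorem stub_formulaILongDualDil : ∃ c₀ : ℝ, ∀ c' : ℝ, c₀ ≤ c' → LongLegSplit.FormulaILongDualDil c' := by
  sorry

/-- stub 3′ (P2-Dil AT THE CELL — its M part is KERNEL: `= lemma81LongPsiDilCell_of_meanSquare L_A`; the open content is
`MeanSquareCellHeads`, price = the one-log room of `𝔠̃ ↦ 𝔠`): Lemma 8.1 with extended truncations for the cell datum, slack
`ε·√D·𝔓`, corner `λ = 2` excluded (automatic on poly pairs with `θ < 1` pieces). Why it might fail: the `Ψ₁` mean square of the
cell's product polynomial may exceed `D·P²·𝓛³⁸` by the `𝓛¹²` that the `τ²/τ` heads of length `D⁴` cost in the class version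
(typer-3 g20) — at the cell, (A)-lacunarity of `υ, ν` is the bet. -/
theorem stub_lemma81LongPsiDilCell : ∃ c₀ : ℝ, ∀ c' : ℝ, c₀ ≤ c' → Lemma81LongPsiDilCell c' := by
  sorry

/-- stub 4 (the DEGREE-1 LONG SLOTS OF RECORD K2 ∧ K1 ∧ P2, KEPT VERBATIM from v1; its K1 conjunct `FormulaILongDual` IS THE
WALL: **«WALL-GATED at `Literature.Barriers.Parity.LargeSieveLevelHalf` (`LargeSieveLevelHalf_holds`), S4 `K1A-DISPLAY-6-U-WRAP.md`
v1.0 6be5f72626c5ee6f, desk 01:48:48Z»** (word of record, ls-lead g6 01:52:01Z (i); S4 §6: O7's `x₁^{long}`, `y₁^{long}` read the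
same bound and the same word); P2 as typed has the same one-log wall as v1's stub 3 — `Theorems.lemma81LongPsi_of_meanSquare`,
typer-3 g20; registered because the degree-1 / dual tables `x₁`, `y₁` on long poly pairs come from nowhere else): formula I for
the long ψ-datum, its dual, and Lemma 8.1 with extended truncations, eventually in `c′`. -/
theorem stub_degOneLongSlots : ∃ c₀ : ℝ, ∀ c' : ℝ, c₀ ≤ c' →
    LongLegSplit.FormulaILongPsi c' ∧ LongLegSplit.FormulaILongDual c' ∧ LongLegSplit.Lemma81LongPsi c' := by
  sorry

/-! ## Part 3 — the class, the SEALED display, the split stub 5 = (5a) transfer + (5b) (A)-free sign test, and the proved glue -/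

/-- The canonical SUB-UNIT POLYNOMIAL pair class (KEPT VERBATIM from v1): both pieces are polynomial short pieces of some
explicit length `θ < 1` (verbatim the class hypothesis `h𝒞` of `KnifeEdge.theorem1_of_gradedClosesPsiOn_pack_eventually_poly`,
hence of `closes`). It contains the LONG poly pairs (`θ_f + θ_g ≥ 1`) of this line and the short ones (typed null); by
monotonicity of `GradedClosesOn` in the class it is the WEAKEST class on which to run the sign test. -/
def SubUnitPolyPairs : PairClass := fun f f' g g' =>
  (∃ θ : ℝ, θ < 1 ∧ PolyShortPiece θ f f') ∧ (∃ θ : ℝ, θ < 1 ∧ PolyShortPiece θ g g')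

/-- `PsiGradedClosedForms` is inhabited (the empty atom lists; used ONLY to seal the display constant below — the witness is
invisible behind `Classical.choice`). -/
theorem psiGradedClosedForms_nonempty : Nonempty PsiGradedClosedForms :=
  ⟨{ x₁ := [], y₁ := [], x₂ := [],
     cont_x₁ := (fun _ ha => nomatch ha),
     cont_y₁ := (fun _ ha => nomatch ha),
     cont_x₂ := (fun _ ha => nomatch ha) }⟩

/-- **THE DISPLAY HOLE, SEALED.** The closed-form triple `(x₁, y₁, x₂)` of the degree-1 cross, degree-1 dual and degree-2 psi
cross tables on LONG sub-unit polynomial pairs — DISPLAY #6 cell (U) for `x₂^{long}` (the main-term constants `X₂^𝕄 + wrap^𝕄_mean`,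
UNEVALUATED as closed forms of record, theory M-RULEBOOK) and owed item O7 for `x₁^{long}`, `y₁^{long}` — has no displayed VALUE
(S4 `K1A-DISPLAY-6-U-WRAP.md` v1.0: only `|cell| ≤ c(D)√(𝔅𝔅)`, `c(D) → ∞`, no lower bound ⇒ UNDECIDED-AT-WALL ⇒ WALL-GATED,
desk-accepted 2026-08-28T01:48:48Z). It is registered as a kernel-OPAQUE constant: by `Classical.choice` nothing about `longPolyForms` beyond its type
`PsiGradedClosedForms` (three finite atom lists with continuous kernels: a bare term, no `χ`, no `D`, no `ForAllLarge` — guard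
(g1)) is provable, so the two stubs over it are DISPLAY-GATED, neither provable nor refutable, until this ONE body is replaced
by the displayed term `E₀` (one-line edit + `ledger skeleton check` re-registration; owed by the tenure planner when S4 / K1″a
lands). A sealed hole is the typed form of «UNEVALUATED»; no number is invented. -/
noncomputable def longPolyForms : PsiGradedClosedForms := Classical.choice psiGradedClosedForms_nonempty

/-- stub 5a (THE TRANSFER — price M off the corner, given the slots; NOT keyable until `longPolyForms` is unsealed): from the
six long-leg slots (degree-1 of record K2 ∧ K1 ∧ P2 and the cell companions P1-cell ∧ K1-Dil ∧ P2-Dil-cell, eventually in `c′`),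
under recurrence of (A), the degree-1 cross, degree-1 dual and degree-2 psi cross tables hold ON `SubUnitPolyPairs` with the
functionals of the closed-form triple `longPolyForms` (all pieces of explicit length `θ < 1`, so `λ = θ_f + θ_g < 2` and the
corner never occurs; the `√D` slacks repaid by `‖τ(χ)⁻¹‖ = D^{−1/2}` at the junction, `TauTwoLowering`; the short half by the
kernel chain `ShortPairsTauTwoDark`; main-term COUNTS of DISPLAY #6 as theorems). The (A)-recurrence guard is logically idle
(under eventual failure of (A) the `…On` tables are vacuous) and kept for the letter of ref-1 finding 1. Why it might fail: the
slots' error terms `C·ℰ + ε√D𝔓` may not be `o(𝔞𝔓)` uniformly on the class after rescaling sup-normalised profiles, or the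
displayed `E₀` may omit a wrap term (M-RULEBOOK: `wrap^𝕄` unevaluated). -/
theorem stub_closedFormsOnClass :
    (∃ c₀ : ℝ, ∀ c' : ℝ, c₀ ≤ c' →
        LongLegSplit.FormulaILongPsi c' ∧ LongLegSplit.FormulaILongDual c' ∧ LongLegSplit.Lemma81LongPsi c' ∧
        FormulaILongPsiDilCell c' ∧ LongLegSplit.FormulaILongDualDil c' ∧ Lemma81LongPsiDilCell c') →
    ¬ Skeleton.ForAllLarge (fun D _ χ => ¬ Skeleton.AssumptionA D χ) →
      ∃ c₀ : ℝ, ∀ c' : ℝ, c₀ ≤ c' →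
        CrossTablePsiOn c' SubUnitPolyPairs 1 longPolyForms.X₁psi ∧
        DualCrossTablePsiOn c' SubUnitPolyPairs 1 longPolyForms.Y₁psi ∧
        CrossTablePsiOn c' SubUnitPolyPairs 2 longPolyForms.X₂psiDiag := by
  sorry

/-- stub 5b (THE (A)-FREE SIGN TEST — the deciding computation of the line; display-gated by the seal, then an explicit-real
inequality search decidable per design): SOME graded design of sub-unit polynomial pieces (the `∃`-design of `GradedClosesOn`
itself — guard (g2), no pinned design; ref-1 desk: the linear `θ = 0.9` design is the MOST EXPENSIVE one, `𝔅 = 41.98…`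
(`Negative.mainTermForm_linearPiece_nine_tenths`), twisted sub-unit poly designs are ≈124× cheaper, `𝔅 < 0.3388`
(`Negative.mainTermForm_kappaP_nine_tenths`, `exists_subUnitPoly_design_lt`)) and amplitudes `s` make the graded main form of
the closed-form triple negative. Instruments of record, both (A)-free: LIVE by `Negative.gradedClosesOn_of_det_neg` /
`_of_minor02/01/12` / `_mixedTriple`; BELOW (kill) by `Negative.not_gradedClosesOn_of_cells_le_mixed` / `_le_half_geom`. Why it
might fail: the degree-1/2 cells may be DARK or PSD-completing on long sub-unit poly pairs too (X2-HOLD «wrap-or-dark») — then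
`¬ 5b` is a theorem the day the display lands and the line dies here. -/
theorem stub_signTestClosedForms :
    GradedClosesOn SubUnitPolyPairs longPolyForms.X₁psi longPolyForms.Y₁psi longPolyForms.X₂psiDiag := by
  sorry

section Glue

open Literature.NumberTheory.LFunctions.Zhang2022.Skeleton
open ComplexConjugate

variable {c' : ℝ} {𝒞 : PairClass} {X₁ Y₁ X₂ X₁' Y₁' X₂' : PairFunctional}

/-- **A restricted DUAL slot pins its functional on its class** (unless (A) fails eventually) — the dual companion of
`KnifeEdge.crossTablePsiOn_unique` (same proof: `asympConst_unique`). [cite: Zhang2022LandauSiegel, §8 (8.5)] -/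
theorem dualCrossTablePsiOn_unique {d : ℕ} {Y Y' : PairFunctional} (h : DualCrossTablePsiOn c' 𝒞 d Y)
    (h' : DualCrossTablePsiOn c' 𝒞 d Y') (hA : ¬ ForAllLarge fun D _ χ => ¬ AssumptionA D χ) {g₁ g₁' g₂ g₂' : ℝ → ℂ}
    (hg₁ : InClassPiece g₁ g₁') (hg₂ : InClassPiece g₂ g₂') (h𝒞 : 𝒞 g₁ g₁' g₂ g₂') :
    Y g₁ g₁' g₂ g₂' = Y' g₁ g₁' g₂ g₂' :=
  asympConst_unique (T := fun D _ χ => zDegMeanPsi c' χ d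
      (fun x t => conj (Repair.profPoly χ x g₂ (⌊bigP D⌋₊ + 1) t))
      (fun x t => conj (Repair.profPoly χ x g₁ (⌊bigP D⌋₊ + 1) t)))
    (fun ε hε => h g₁ g₁' g₂ g₂' hg₁ hg₂ h𝒞 ε hε) (fun ε hε => h' g₁ g₁' g₂ g₂' hg₁ hg₂ h𝒞 ε hε) hA

/-- **`GradedClosesOn 𝒞` TRANSFERS between table-witnesses ON the class, on the (A)-i.o. horn (PROVED; the glue of the
split stub 5):** two triples filling the degree-1 cross, degree-1 dual and degree-2 cross tables ON `𝒞` at the same `c′` agree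
on every in-class pair OF `𝒞` (`crossTablePsiOn_unique`, `dualCrossTablePsiOn_unique`), and `GradedClosesOn 𝒞` evaluates the
functionals only at pairs of `𝒞` (`gradedMainMatrix_congr`). The ON-class analogue of `KnifeEdge.gradedCloses_transfer`.
[cite: Zhang2022LandauSiegel, §2 (2.16), §8 (8.5)] -/
theorem gradedClosesOn_transfer (hA : ¬ ForAllLarge fun D _ χ => ¬ AssumptionA D χ)
    (h1 : CrossTablePsiOn c' 𝒞 1 X₁) (h21 : DualCrossTablePsiOn c' 𝒞 1 Y₁) (h2 : CrossTablePsiOn c' 𝒞 2 X₂)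
    (h1' : CrossTablePsiOn c' 𝒞 1 X₁') (h21' : DualCrossTablePsiOn c' 𝒞 1 Y₁') (h2' : CrossTablePsiOn c' 𝒞 2 X₂')
    (hC : GradedClosesOn 𝒞 X₁ Y₁ X₂) : GradedClosesOn 𝒞 X₁' Y₁' X₂' := by
  obtain ⟨f, f', g₁, g₁', g₂, g₂', s, hf, hg₁, hg₂, c₁, c₂, c₃, hneg⟩ := hC
  refine ⟨f, f', g₁, g₁', g₂, g₂', s, hf, hg₁, hg₂, c₁, c₂, c₃, ?_⟩
  rwa [← gradedMainMatrix_congr (crossTablePsiOn_unique h1 h1' hA hf hg₁ c₁)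
    (dualCrossTablePsiOn_unique h21 h21' hA hg₁ hg₂ c₃) (crossTablePsiOn_unique h2 h2' hA hf hg₂ c₂)]

end Glue

/-! ## Part 4 — the composition -/

/-- **`PsiGradedTablesClosePoly_of : PsiGradedTablesClosePoly`** — the ONLY theorem of this file concluding the crux,
hypothesis-free: the six `stub_*` theorems composed — the six eventual slot thresholds joined by `max`, the class witness
`𝒞 := SubUnitPolyPairs` (its per-piece `θ < 1` property is its definition), the tables ON the class for the sealed closed forms
(stub 5a), their (A)-free closing (stub 5b), and the PROVED transfer `gradedClosesOn_transfer` to every table-witness.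
Sorries live ONLY inside `stub_*`. -/
theorem PsiGradedTablesClosePoly_of : PsiGradedTablesClosePoly := by
  intro hA
  obtain ⟨c₁, h1⟩ := stub_formulaILongPsiDilCell
  obtain ⟨c₂, h2⟩ := stub_formulaILongDualDil
  obtain ⟨c₃, h3⟩ := stub_lemma81LongPsiDilCell
  obtain ⟨c₄, h4⟩ := stub_degOneLongSlots
  have hslots : ∃ c₀ : ℝ, ∀ c' : ℝ, c₀ ≤ c' →
      LongLegSplit.FormulaILongPsi c' ∧ LongLegSplit.FormulaILongDual c' ∧ LongLegSplit.Lemma81LongPsi c' ∧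
      FormulaILongPsiDilCell c' ∧ LongLegSplit.FormulaILongDualDil c' ∧ Lemma81LongPsiDilCell c' := by
    refine ⟨max (max c₁ c₂) (max c₃ c₄), fun c' hc' => ?_⟩
    have h12 : max c₁ c₂ ≤ c' := (le_max_left _ _).trans hc'
    have h34 : max c₃ c₄ ≤ c' := (le_max_right _ _).trans hc'
    obtain ⟨hK2, hK1, hP2⟩ := h4 c' ((le_max_right _ _).trans h34)
    exact ⟨hK2, hK1, hP2, h1 c' ((le_max_left _ _).trans h12), h2 c' ((le_max_right _ _).trans h12),
      h3 c' ((le_max_left _ _).trans h34)⟩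
  obtain ⟨c₀, hT⟩ := stub_closedFormsOnClass hslots hA
  refine ⟨SubUnitPolyPairs, fun f f' g g' h => h, c₀, fun c' hc' X₁ Y₁ X₂ hX₁ hY₁ hX₂ => ?_⟩
  obtain ⟨e1, e21, e2⟩ := hT c' hc'
  exact gradedClosesOn_transfer hA e1 e21 e2 hX₁ hY₁ hX₂ stub_signTestClosedForms

end Summit.Parity.GeneralizedHardyLittlewood.Cruxes.PsiGradedTablesClosePoly.LongPolyDil
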